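import Summits.BirchSwinnertonDyer.BirchSwinnertonDyer.Theorems.Rank2Observatory2DescClRealCertSound
import Summits.BirchSwinnertonDyer.BirchSwinnertonDyer.Theorems.Rank2Observatory2DescClRowCertLe
import HarnessLib

/-!
# BirchSwinnertonDyer — rank ≥ 2 observatory: KERNEL-2DESC-CL v2.2 (totally real 2-division fields) — the per-curve certificate with the RANK BOUND AS A PARAMETER (`checkRLe r`, `rank E(ℚ) ≤ r` / `= r`)

HONEST FRAMING: per-curve certified theorems and census instruments; no claim on BSD in rank ≥ 2.

Generic addendum of the reflective class-group-general kernel 2-descent over a TOTALLY REAL cubic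
2-division field (cell `b2b-bsdr2`, seat cert-1; design `b2b-bsdr2-cert-1/KERNEL-2DESC-CL.md` §7.1–7.2;
rank-3 port spec `code/b2b-bsdr2-cert-2/v2/RANK3-V2.md` §8). The landed checker `checkR fr ccr`
(`Rank2Observatory2DescClRealCert`) ends in `#{admissible classes} ≤ 2²` and `rank_le_two_of_checkR`
(`Rank2Observatory2DescClRealCertSound`) concludes `rank E(ℚ) ≤ 2`. As in the complex companion
`Rank2Observatory2DescClRowCertLe`, the admissible classes contain the image of `E(ℚ)/2E(ℚ)` of size
`2^rank`, so the strict count `#{admissible} < 2^(r+1)` gives `rank E(ℚ) ≤ r`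
(`mordellWeilRank_le_of_coverSet_cl_lt`). This file defines `checkRLe r fr ccr` = `checkR fr ccr` with the
LAST clause replaced by `card < 2 ^ (r + 1)` (every other clause byte-identical: model, `θ_E`, `D`, norm
factorisation against the registry, `D ∉ W₁, W₂`, `famCheckR` of the family incl. the three real signs, the
two `linLtCond` place-order clauses, the parity certificate over `chars.length + 5` rows), proves
`rank_le_of_checkRLe` (the landed proof verbatim with the count generalised) and the `K`-free wrappers
`rank_eq_of_certsRLe` / `rank_eq_of_certsRLe_complSq` over `CubicField a b c` with a tree lower bound
`r ≤ rank` (`r = 3`: `Rank3KernelCerts<k>.C<label>.three_le_rank` — `8` admissible classes ⇒ `rank ≤ 3`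
with no kill layer; for `r = 2` it accepts exactly the rows `checkR` accepts, the count being a power of two).
Shape of a sharded rank-`r` row: `theorem C<label>.mordellWeilRank_eq_three : (…).mordellWeilRank = 3 :=
<field plumbing thm> ⟨⟨curve literal⟩, o₀, o₁, o₂⟩ (by decide +kernel) <lower bound>` with the plumbing theorem
`rank_eq_of_certsRLe 3 <field literal> ccr (by decide +kernel) (…) hc hlow` stated once per field block.
Sorry-free; axioms `propext`, `Classical.choice`, `Quot.sound`.
[cite: Cassels1991LecturesEllipticCurves, §15] [cite: CremonaAlgorithms1997, §3.6] [cite: Cohen1993, §4.8.2, §6.5]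
-/

set_option linter.dupNamespace false

noncomputable section

open scoped NumberField nonZeroDivisors

open Literature.NumberTheory.NumberFields Polynomial Module NumberField IsDedekindDomain Ideal

namespace Summit.BirchSwinnertonDyer.BirchSwinnertonDyer.Rank2Observatory.TwoDescCl

open TwoDescCubic ClFieldCert

/-! ## The `r`-checker over a totally real field -/

/-- **The per-curve checker over a totally real 2-division field with the rank bound as a parameter**: the
clauses of `checkR fr ccr` and, last, FEWER THAN `2^(r+1)` admissible classes. Computable; run by
`decide +kernel`. [cite: Cassels1991LecturesEllipticCurves, §15] [cite: CremonaAlgorithms1997, §3.6] -/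
def checkRLe (r : ℕ) (fr : ClFieldCertR) (ccr : ClCurveCertR) : Bool :=
  decide (deltaShort ccr.cc.A ccr.cc.B ccr.cc.C ≠ 0) &&
    noRootMod ccr.cc.pF ccr.cc.A ccr.cc.B ccr.cc.C &&
    decide (cubicAtCoords fr.core.a fr.core.b fr.core.c ccr.cc.A ccr.cc.B ccr.cc.C ccr.cc.t = (0, 0, 0)) &&
    decide (derivAtCoords fr.core.a fr.core.b fr.core.c ccr.cc.A ccr.cc.B ccr.cc.t =
      MonicCubic.mulCoords fr.core.a fr.core.b fr.core.c ccr.cc.D (prodPowCoords fr.core.a fr.core.b fr.core.c [])) &&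
    decide (0 < MonicCubic.disc ccr.cc.A ccr.cc.B ccr.cc.C) &&
    decide (normFormZ fr.core.a fr.core.b fr.core.c ccr.cc.D.1 ccr.cc.D.2.1 ccr.cc.D.2.2 ≠ 0) &&
    decide ((normFormZ fr.core.a fr.core.b fr.core.c ccr.cc.D.1 ccr.cc.D.2.1 ccr.cc.D.2.2).natAbs =
      (ccr.cc.dn.map fun pe => pe.1 ^ pe.2).prod) &&
    (ccr.cc.dn.all fun pe => (fr.core.primes.any fun e => e.p == pe.1) &&
      ((fr.core.row pe.1).codes.all fun C' => decide (C' ∈ ccr.cc.codes) ||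
        ccr.cc.dinv.any fun ci => ci.1 == C' && invCert fr.core.a fr.core.b fr.core.c C' ccr.cc.D ci.2)) &&
    (ccr.cc.codes.all fun C => (fr.core.primes.any fun e => e.p == C.1) && decide (C ∈ (fr.core.row C.1).codes)) &&
    invCert fr.core.a fr.core.b fr.core.c fr.core.w₁ ccr.cc.D ccr.cc.dW1 &&
    invCert fr.core.a fr.core.b fr.core.c fr.core.w₂ ccr.cc.D ccr.cc.dW2 &&
    (ccr.cc.Q.all fun q => decide (0 < q)) &&
    ((famR fr ccr.cc).all fun f => famCheckR fr ccr.cc.D f) &&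
    (linLtCond (fr.I ccr.o₀).1 (fr.I ccr.o₀).2 (fr.I ccr.o₁).1 (fr.I ccr.o₁).2 ccr.cc.t &&
      linLtCond (fr.I ccr.o₁).1 (fr.I ccr.o₁).2 (fr.I ccr.o₂).1 (fr.I ccr.o₂).2 ccr.cc.t) &&
    decide (∀ T : Finset (Fin (famR fr ccr.cc).length), T ≠ ∅ →
      ∃ k : Fin (fr.core.chars.length + 5), Odd (T.filter fun j => bitR fr ccr.cc k j = true).card) &&
    decide (((Finset.univ ×ˢ Finset.univ).filter
      (fun p : Finset (Fin 0) × Finset (Fin (famR fr ccr.cc).length) => admR fr ccr p.1 p.2 = true)).card <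
        2 ^ (r + 1))

/-! ## Soundness -/

section Sound

variable {K : Type*} [Field K] [NumberField K] {θ : K}

/-- **Soundness of the `r`-checker over a totally real field: `rank E(ℚ) ≤ r`** (the proof of
`rank_le_two_of_checkR` with the count generalised). [cite: Cassels1991LecturesEllipticCurves, §15] -/
theorem rank_le_of_checkRLe (r : ℕ) (fr : ClFieldCertR)
    (hθ : aeval θ (MonicCubic.poly fr.core.a fr.core.b fr.core.c) = 0)
    (h3 : finrank ℚ K = 3) (hF : fr.check = true) (hpr : fr.core.primeList.Forall Nat.Prime) (ccr : ClCurveCertR)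
    (hc : checkRLe r fr ccr = true) :
    ((⟨0, ccr.cc.A, 0, ccr.cc.B, ccr.cc.C⟩ : WeierstrassCurve ℚ)).mordellWeilRank ≤ r := by
  classical
  have hC := fr.core_of_check hF
  have hirr := fr.irreducible_of_check hF
  have hq := fr.core.q_prime hpr
  have h0 := fr.lo_nonneg_of_check hF
  set fc := fr.core with hfc
  set cc := ccr.cc with hcc
  simp only [checkRLe, Bool.and_eq_true, decide_eq_true_eq, List.all_eq_true, List.any_eq_true,
    Bool.or_eq_true, beq_iff_eq] at hc
  obtain ⟨⟨⟨⟨⟨⟨⟨⟨⟨⟨⟨⟨⟨⟨⟨hΔ, hirrF⟩, hcub⟩, hder⟩, hdisc⟩, hND0⟩, hdn⟩, hdnC⟩, hcodes⟩, hdW1⟩, hdW2⟩, hQ⟩,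
    hfamAll⟩, hord⟩, hcert⟩, hcount⟩ := hc
  haveI hE := isElliptic_of_deltaShort_ne hΔ
  have hirrF' := irreducible_of_noRootMod hirrF
  -- `θ_E`, `D`, `M = D·q`
  have haev := aeval_lin_eq_zero_of_coords hθ cc.t hcub
  have hderiv : (3 : 𝓞 K) * (lin hθ cc.t.1 cc.t.2.1 cc.t.2.2) ^ 2 +
      2 * ((cc.A : ℤ) : 𝓞 K) * (lin hθ cc.t.1 cc.t.2.1 cc.t.2.2) + ((cc.B : ℤ) : 𝓞 K) =
        lin hθ cc.D.1 cc.D.2.1 cc.D.2.2 := by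
    simpa using deriv_eq_of_coords hθ cc.t cc.D [] hder
  have hD0 : (lin hθ cc.D.1 cc.D.2.1 cc.D.2.2 : 𝓞 K) ≠ 0 := lin_ne_zero_of_coords hirr hθ h3 _ hND0
  have hq0 : ((fc.q : ℕ) : 𝓞 K) ≠ 0 := by exact_mod_cast hq.ne_zero
  have hM0 : (lin hθ cc.D.1 cc.D.2.1 cc.D.2.2 : 𝓞 K) * ((fc.q : ℕ) : 𝓞 K) ≠ 0 := mul_ne_zero hD0 hq0
  have hgen := closure_tsupp_eq_top_of_dvd
    (dvd_mul_left ((fc.q : ℕ) : 𝓞 K) (lin hθ cc.D.1 cc.D.2.1 cc.D.2.2)) (fc.closure_q_eq_top_of_core hθ h3 hC hpr)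
  have hDM : ∀ v : HeightOneSpectrum (𝓞 K), (3 : 𝓞 K) * (lin hθ cc.t.1 cc.t.2.1 cc.t.2.2) ^ 2 +
      2 * ((cc.A : ℤ) : 𝓞 K) * (lin hθ cc.t.1 cc.t.2.1 cc.t.2.2) + ((cc.B : ℤ) : 𝓞 K) ∈ v.asIdeal →
      (lin hθ cc.D.1 cc.D.2.1 cc.D.2.2 : 𝓞 K) * ((fc.q : ℕ) : 𝓞 K) ∈ v.asIdeal := by
    intro v hv
    rw [hderiv] at hv
    exact Ideal.mul_mem_right _ _ hv
  have hDW₁ : (lin hθ cc.D.1 cc.D.2.1 cc.D.2.2 : 𝓞 K) ∉ (fc.W₁c hθ h3 hC hpr).asIdeal :=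
    lin_not_mem_of_invCert hθ _ (W₁c_asIdeal hθ h3 hC hpr) hdW1
  have hDW₂ : (lin hθ cc.D.1 cc.D.2.1 cc.D.2.2 : 𝓞 K) ∉ (fc.W₂c hθ h3 hC hpr).asIdeal :=
    lin_not_mem_of_invCert hθ _ (W₂c_asIdeal hθ h3 hC hpr) hdW2
  -- the support `T = {W₁, W₂} ∪ codes`
  set L := cc.codes.length with hL
  let Tf : Fin (L + 2) → HeightOneSpectrum (𝓞 K) := Matrix.vecCons (fc.W₁c hθ h3 hC hpr)
    (Matrix.vecCons (fc.W₂c hθ h3 hC hpr) fun i => codePrimeC hθ h3 hC hpr (cc.codes.get i))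
  have hT : ∀ w : HeightOneSpectrum (𝓞 K),
      (lin hθ cc.D.1 cc.D.2.1 cc.D.2.2 : 𝓞 K) * ((fc.q : ℕ) : 𝓞 K) ∈ w.asIdeal → ∃ i, Tf i = w := by
    intro w hw
    rcases w.isPrime.mem_or_mem hw with hD | hqw
    · obtain ⟨l, hl, hldvd, hlw⟩ := exists_prime_dvd_norm_mem w hD0 hD
      rw [natAbs_norm_lin_coords hirr hθ h3, hdn] at hldvd
      obtain ⟨a, ha, hla⟩ := (Prime.dvd_prod_iff hl.prime).mp hldvd
      obtain ⟨pe, hpe, rfl⟩ := List.mem_map.mp ha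
      obtain ⟨hany, hrowcodes⟩ := hdnC pe hpe
      have hany' : (fc.primes.any fun e => e.p == pe.1) = true := by simpa [List.any_eq_true] using hany
      obtain ⟨hrow, hrowp⟩ := row_mem hany'
      have hpp : (fc.row pe.1).p.Prime := fc.prime_of_mem hpr hrow
      have hl_eq : l = pe.1 :=
        (Nat.prime_dvd_prime_iff_eq hl (hrowp ▸ hpp)).mp (hl.dvd_of_dvd_pow hla)
      have hlw' : ((fc.row pe.1).p : 𝓞 K) ∈ w.asIdeal := by rw [hrowp, ← hl_eq]; exact hlw
      obtain ⟨C', hC', hw'⟩ :=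
        exists_code_of_natCast_mem hirr hθ h3 hpp (fc.row_check_of_mem_core hC hrow).1 w hlw'
      rcases hrowcodes C' hC' with hmem | ⟨ci, -, hci, hinv⟩
      · obtain ⟨i, hi⟩ := List.mem_iff_get.mp hmem
        obtain ⟨hc1, hc2⟩ := hcodes _ (List.get_mem _ i)
        have hc1' : (fc.primes.any fun e => e.p == (cc.codes.get i).1) = true := by
          simpa [List.any_eq_true] using hc1
        refine ⟨i.succ.succ, HeightOneSpectrum.ext ?_⟩
        simp only [Tf, Matrix.cons_val_succ]
        rw [codePrimeC_asIdeal hθ h3 hC hpr hc1' hc2, hi, hw']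
      · exact absurd hD (lin_not_mem_of_invCert hθ w hw' hinv)
    · rcases eq_W₁c_or_W₂c hθ h3 hC hpr w hqw with rfl | rfl
      · exact ⟨0, by simp [Tf]⟩
      · exact ⟨1, by simp [Tf]⟩
  -- the family
  set fm := famR fr cc with hfm
  let W : Fin fm.length → 𝓞 K := fun j => lin hθ (fm.get j).2.2.g.1 (fm.get j).2.2.g.2.1 (fm.get j).2.2.g.2.2
  have hfam : ∀ j : Fin fm.length, famCheckR fr cc.D (fm.get j) = true := fun j => hfamAll _ (List.get_mem _ j)
  have hfam1 : ∀ j : Fin fm.length, famCheck fc cc.D (fm.get j) = true := fun j => famCheck_of_famCheckR (hfam j)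
  have hW0 : ∀ j, W j ≠ 0 := fun j => lin_ne_zero_of_famCheck_core hθ h3 hC (hfam1 j)
  have hWval : ∀ j (v : HeightOneSpectrum (𝓞 K)),
      (lin hθ cc.D.1 cc.D.2.1 cc.D.2.2 : 𝓞 K) * ((fc.q : ℕ) : 𝓞 K) ∉ v.asIdeal →
        v.valuation K (algebraMap (𝓞 K) K (W j)) = 1 :=
    fun j v hv => valuation_eq_one_of_support _ _ (supp_of_famCheck_core hθ h3 hC hpr (hfam1 j)) v hv
  obtain ⟨ρ, hρ⟩ := fr.exists_rho_of_check hθ h3 hF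
  have hsg : ∀ (k : Fin 3) (j : Fin fm.length),
      (sgAt fr (fm.get j) k = true ↔ ρ k (algebraMap (𝓞 K) K (W j)) < 0) :=
    fun k j => sgAt_iff_of_famCheckR hθ ρ h0 hρ (hfam j) k
  have hρ0 : ∀ (k : Fin 3) (j : Fin fm.length), ρ k (algebraMap (𝓞 K) K (W j)) ≠ 0 :=
    fun k j => rho_ne_zero_of_famCheckR hθ ρ h0 hρ (hfam j) k
  -- independence modulo squares: the parity certificate
  have hind : ∀ S : Finset (Fin fm.length), IsSquare (∏ i ∈ S, algebraMap (𝓞 K) K (W i)) → S = ∅ := by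
    intro S hS
    refine indep_of_parity_certificate (fun i => algebraMap (𝓞 K) K (W i)) (bitR fr cc) ?_ hcert S hS
    intro k S' hS'
    have hS'' : IsSquare (∏ i ∈ S', W i) := isSquare_prod_of_isSquare_prod_coe _ hS'
    have hreal : ∀ kk : Fin 3,
        Even (S'.filter fun i => sgAt fr (fm.get i) kk = true).card := fun kk => by
      have h := even_card_of_isSquare_real (ρ kk) (fun i => algebraMap (𝓞 K) K (W i)) (fun i => hρ0 kk i) hS'
      convert h using 2
      exact Finset.filter_congr (fun i _ => hsg kk i)
    obtain ⟨k, hk⟩ := k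
    rcases k with _ | _ | _ | _ | _ | k
    · simpa [bitR, bitRowR, sgAt] using hreal 0
    · simpa [bitR, bitRowR, sgAt] using hreal 1
    · simpa [bitR, bitRowR, sgAt] using hreal 2
    · exact even_card_of_isSquare_valuation (fc.W₁c hθ h3 hC hpr) W hW0 _
        (fun i => by
          show ((!decide ((2 : ℤ) ∣ famL₁ (fm.get i))) = true ↔ _)
          rw [log_W₁c_of_famCheck hθ h3 hC hpr (hfam1 i)]; simp) hS'
    · exact even_card_of_isSquare_valuation (fc.W₂c hθ h3 hC hpr) W hW0 _
        (fun i => by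
          show ((!decide ((2 : ℤ) ∣ famL₂ (fm.get i))) = true ↔ _)
          rw [log_W₂c_of_famCheck hθ h3 hC hpr (hfam1 i)]; simp) hS'
    · have hk' : k < fc.chars.length := by rw [hfc]; omega
      have hch : fc.chars.getD k ((3 : ℕ), (0 : ℤ), (0 : ℤ)) ∈ fc.chars := by
        rw [List.getD_eq_getElem?_getD, List.getElem?_eq_getElem hk', Option.getD_some]
        exact List.getElem_mem hk'
      obtain ⟨h2, ψ, hψ⟩ := fc.exists_psi_of_core hθ h3 hC hpr hch
      haveI : Fact (fc.chars.getD k (3, 0, 0)).1.Prime := ⟨fc.char_prime hpr hch⟩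
      have h := even_card_filter_eulerBit hθ (ℓ := (fc.chars.getD k (3, 0, 0)).1) (by omega) ψ hψ
        (fun i => (fm.get i).2.2.g) (fun i => not_dvd_evalInt_of_famCheck (hfam1 i) hch) hS''
      convert h using 2
      exact Finset.filter_congr (fun i _ => Iff.rfl)
  -- spanning of the `T`-units modulo squares
  have hodd : Odd (finrank ℚ K) := by rw [h3]; decide
  have hn : fm.length = NumberField.Units.rank K + 1 + (L + 2) := by
    rw [fr.units_rank_of_check hθ h3 hF]
    simp only [hfm, famR, fam, List.length_cons, List.length_map, hL]
    omega
  have hspan : ∀ u : K, u ≠ 0 →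
      (∀ v : HeightOneSpectrum (𝓞 K),
        (lin hθ cc.D.1 cc.D.2.1 cc.D.2.2 : 𝓞 K) * ((fc.q : ℕ) : 𝓞 K) ∉ v.asIdeal → v.valuation K u = 1) →
      ∃ U : Finset (Fin fm.length), IsSquare (u * ∏ j ∈ U, algebraMap (𝓞 K) K (W j)) :=
    fun u hu huT => exists_isSquare_tunit_mul_prod hodd _ Tf hT hn (fun j => algebraMap (𝓞 K) K (W j))
      (fun j => RingOfIntegers.coe_ne_zero_iff.mpr (hW0 j)) hWval hind u hu huT
  -- the sieve is sound at rational points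
  have hθQ : ∀ x : ℚ, algebraMap ℚ K x ≠ algebraMap (𝓞 K) K (lin hθ cc.t.1 cc.t.2.1 cc.t.2.2) :=
    ne_of_powIndep (powIndep_algebraMap hirrF' haev h3)
  have hFrel : (lin hθ cc.t.1 cc.t.2.1 cc.t.2.2 : 𝓞 K) ^ 3 + cc.A * (lin hθ cc.t.1 cc.t.2.1 cc.t.2.2) ^ 2 +
      cc.B * (lin hθ cc.t.1 cc.t.2.1 cc.t.2.2) + cc.C = 0 := by
    apply RingOfIntegers.coe_injective
    simpa only [map_add, map_mul, map_pow, map_intCast, _root_.map_zero] using MonicCubic.theta_rel haev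
  -- the `θ_E`-order of the places
  have h12 : ρ ccr.o₀ ((lin hθ cc.t.1 cc.t.2.1 cc.t.2.2 : 𝓞 K) : K) <
      ρ ccr.o₁ ((lin hθ cc.t.1 cc.t.2.1 cc.t.2.2 : 𝓞 K) : K) :=
    lin_lt_lin hθ (ρ ccr.o₀) (ρ ccr.o₁) (h0 _) (hρ _).1 (hρ _).2 (h0 _) (hρ _).1 (hρ _).2 _ _ _
      (of_decide_eq_true hord.1)
  have h23 : ρ ccr.o₁ ((lin hθ cc.t.1 cc.t.2.1 cc.t.2.2 : 𝓞 K) : K) <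
      ρ ccr.o₂ ((lin hθ cc.t.1 cc.t.2.1 cc.t.2.2 : 𝓞 K) : K) :=
    lin_lt_lin hθ (ρ ccr.o₁) (ρ ccr.o₂) (h0 _) (hρ _).1 (hρ _).2 (h0 _) (hρ _).1 (hρ _).2 _ _ _
      (of_decide_eq_true hord.2)
  have hadm0 : admR fr ccr ∅ ∅ = true := by
    simp only [admR, Bool.and_eq_true, decide_eq_true_eq, Finset.filter_empty, Finset.card_empty]
    exact ⟨⟨admStd3RQ_empty _ hQ _ _ _ _ _ _ _ _, by decide⟩, by decide⟩
  have hadm : ∀ x y : ℚ, y ^ 2 = x ^ 3 + cc.A * x ^ 2 + cc.B * x + cc.C →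
      ∀ (T : Finset (Fin 0)) (U : Finset (Fin fm.length)),
        IsSquare ((algebraMap ℚ K x - algebraMap (𝓞 K) K (lin hθ cc.t.1 cc.t.2.1 cc.t.2.2)) *
          (∏ i ∈ T, algebraMap (𝓞 K) K (((fun i : Fin 0 => i.elim0 : Fin 0 → (𝓞 K)ˣ) i : (𝓞 K)ˣ) : 𝓞 K)) *
            ∏ j ∈ U, algebraMap (𝓞 K) K (W j)) → admR fr ccr T U = true := by
    intro x y hxy T U hsq
    have h1 : admStd3R (fun i : Fin 0 => i.elim0) (famNormR fr cc) (fun i : Fin 0 => i.elim0)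
        (fun i : Fin 0 => i.elim0) (fun i : Fin 0 => i.elim0) (fun j => sgAt fr (fm.get j) ccr.o₀)
        (fun j => sgAt fr (fm.get j) ccr.o₁) (fun j => sgAt fr (fm.get j) ccr.o₂) T U = true :=
      admStd3R_sound hirrF' haev h3 (ρ ccr.o₀) (ρ ccr.o₁) (ρ ccr.o₂) h12 h23
        (w := fun i : Fin 0 => algebraMap (𝓞 K) K
          (((fun i : Fin 0 => i.elim0 : Fin 0 → (𝓞 K)ˣ) i : (𝓞 K)ˣ) : 𝓞 K))
        (g := fun j => algebraMap (𝓞 K) K (W j)) (fun i => i.elim0)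
        (fun j => RingOfIntegers.coe_ne_zero_iff.mpr (hW0 j)) (fun i => i.elim0)
        (fun j => norm_of_famCheck_core hθ h3 hC) (fun i => i.elim0) (fun i => i.elim0) (fun i => i.elim0)
        (fun j => hsg _ j) (fun j => hsg _ j) (fun j => hsg _ j) x y hxy T U hsq
    have h2 := valRow_sound hFrel hθQ (fc.W₁c hθ h3 hC hpr) (by rw [hderiv]; exact hDW₁) hW0
      (r := fun j => bitRowR fr (fm.get j) 3) (fun j => by
        show ((!decide ((2 : ℤ) ∣ famL₁ (fm.get j))) = true ↔ _)
        rw [show algebraMap (𝓞 K) K (W j) = ((W j : 𝓞 K) : K) from rfl,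
          log_W₁c_of_famCheck hθ h3 hC hpr (hfam1 j)]; simp) x y hxy T U hsq
    have h3' := valRow_sound hFrel hθQ (fc.W₂c hθ h3 hC hpr) (by rw [hderiv]; exact hDW₂) hW0
      (r := fun j => bitRowR fr (fm.get j) 4) (fun j => by
        show ((!decide ((2 : ℤ) ∣ famL₂ (fm.get j))) = true ↔ _)
        rw [show algebraMap (𝓞 K) K (W j) = ((W j : 𝓞 K) : K) from rfl,
          log_W₂c_of_famCheck hθ h3 hC hpr (hfam1 j)]; simp) x y hxy T U hsq
    simp only [admR, Bool.and_eq_true]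
    exact ⟨⟨admStd3RQ_of_admStd3R hQ h1, h2⟩, h3'⟩
  exact mordellWeilRank_le_of_coverSet_cl_lt (A := cc.A) (B := cc.B) (C := cc.C)
    (⟨0, cc.A, 0, cc.B, cc.C⟩ : WeierstrassCurve ℚ) rfl rfl rfl rfl rfl hirrF' haev h3 hM0 hgen hDM hW0 hspan
    (Wu := fun i : Fin 0 => i.elim0) (adm := admR fr ccr) hadm0 hadm (s' := r) hcount

/-- **`rank E(ℚ) = r`** from checked records and a tree lower bound `r ≤ rank` (totally real field).
[cite: CremonaAlgorithms1997, §3.6] -/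
theorem rank_eq_of_checkRLe (r : ℕ) (fr : ClFieldCertR)
    (hθ : aeval θ (MonicCubic.poly fr.core.a fr.core.b fr.core.c) = 0)
    (h3 : finrank ℚ K = 3) (hF : fr.check = true) (hpr : fr.core.primeList.Forall Nat.Prime) (ccr : ClCurveCertR)
    (hc : checkRLe r fr ccr = true)
    (hlow : r ≤ (((⟨0, ccr.cc.A, 0, ccr.cc.B, ccr.cc.C⟩ : WeierstrassCurve ℤ)).map (Int.castRingHom ℚ)).mordellWeilRank) :
    (((⟨0, ccr.cc.A, 0, ccr.cc.B, ccr.cc.C⟩ : WeierstrassCurve ℤ)).map (Int.castRingHom ℚ)).mordellWeilRank = r := by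
  have hE : ((⟨0, ccr.cc.A, 0, ccr.cc.B, ccr.cc.C⟩ : WeierstrassCurve ℤ)).map (Int.castRingHom ℚ) =
      (⟨0, ccr.cc.A, 0, ccr.cc.B, ccr.cc.C⟩ : WeierstrassCurve ℚ) := by
    ext <;> simp [WeierstrassCurve.map]
  refine le_antisymm ?_ hlow
  rw [hE]
  exact rank_le_of_checkRLe r fr hθ h3 hF hpr ccr hc

end Sound

/-! ## `K`-free wrappers over the model `CubicField a b c` (the shape of every sharded rank-`r` row) -/

/-- **`rank E(ℚ) = r` from the two records** (model `(0, A, 0, B, C)`, totally real 2-division field):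
`rank_eq_of_certsRLe r <field> ⟨⟨curve⟩, o₀, o₁, o₂⟩ (by decide +kernel) (by norm_num …) (by decide +kernel) <lower bound>`.
[cite: Cassels1991LecturesEllipticCurves, §15] [cite: CremonaAlgorithms1997, §3.6] -/
theorem rank_eq_of_certsRLe (r : ℕ) (fr : ClFieldCertR) (ccr : ClCurveCertR) (hF : fr.check = true)
    (hpr : fr.core.primeList.Forall Nat.Prime) (hc : checkRLe r fr ccr = true)
    (hlow : r ≤ (((⟨0, ccr.cc.A, 0, ccr.cc.B, ccr.cc.C⟩ : WeierstrassCurve ℤ)).map (Int.castRingHom ℚ)).mordellWeilRank) :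
    (((⟨0, ccr.cc.A, 0, ccr.cc.B, ccr.cc.C⟩ : WeierstrassCurve ℤ)).map (Int.castRingHom ℚ)).mordellWeilRank = r := by
  haveI : Fact (Irreducible (MonicCubic.polyQ fr.core.a fr.core.b fr.core.c)) := ⟨fr.irreducible_of_check hF⟩
  exact rank_eq_of_checkRLe (K := CubicField fr.core.a fr.core.b fr.core.c) r fr
    (CubicField.aeval_root fr.core.a fr.core.b fr.core.c) (CubicField.finrank_eq fr.core.a fr.core.b fr.core.c)
    hF hpr ccr hc hlow

/-- **`rank E(ℚ) = r` for the ORIGINAL model** `(a₁, a₂, a₃, a₄, a₆)` when the records certify its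
completed-square model `(0, a₁² + 4a₂, 0, 8(a₁a₃ + 2a₄), 16(a₃² + 4a₆))` (totally real 2-division field).
[cite: CremonaAlgorithms1997, §3.6] -/
theorem rank_eq_of_certsRLe_complSq (r : ℕ) (fr : ClFieldCertR) (ccr : ClCurveCertR) (hF : fr.check = true)
    (hpr : fr.core.primeList.Forall Nat.Prime) (hc : checkRLe r fr ccr = true) (a₁ a₂ a₃ a₄ a₆ : ℤ)
    (hABC : ccr.cc.A = a₁ ^ 2 + 4 * a₂ ∧ ccr.cc.B = 8 * (a₁ * a₃ + 2 * a₄) ∧ ccr.cc.C = 16 * (a₃ ^ 2 + 4 * a₆))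
    (hlow : r ≤ (((⟨a₁, a₂, a₃, a₄, a₆⟩ : WeierstrassCurve ℤ)).map (Int.castRingHom ℚ)).mordellWeilRank) :
    (((⟨a₁, a₂, a₃, a₄, a₆⟩ : WeierstrassCurve ℤ)).map (Int.castRingHom ℚ)).mordellWeilRank = r := by
  obtain ⟨hA, hB, hC⟩ := hABC
  have hV : ((⟨0, ccr.cc.A, 0, ccr.cc.B, ccr.cc.C⟩ : WeierstrassCurve ℤ)).map (Int.castRingHom ℚ) =
      (⟨Units.mk0 (1 / 2 : ℚ) (by norm_num), 0, -(a₁ : ℚ) / 2, -(a₃ : ℚ) / 2⟩ :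
        WeierstrassCurve.VariableChange ℚ) •
        (((⟨a₁, a₂, a₃, a₄, a₆⟩ : WeierstrassCurve ℤ)).map (Int.castRingHom ℚ)) := by
    ext <;> simp only [WeierstrassCurve.map_a₁, WeierstrassCurve.map_a₂, WeierstrassCurve.map_a₃,
      WeierstrassCurve.map_a₄, WeierstrassCurve.map_a₆, WeierstrassCurve.variableChange_a₁,
      WeierstrassCurve.variableChange_a₂, WeierstrassCurve.variableChange_a₃,
      WeierstrassCurve.variableChange_a₄, WeierstrassCurve.variableChange_a₆, Units.val_inv_eq_inv_val,
      Units.val_mk0, hA, hB, hC, eq_intCast, Int.cast_zero] <;> push_cast <;> ring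
  have hr : (((⟨0, ccr.cc.A, 0, ccr.cc.B, ccr.cc.C⟩ : WeierstrassCurve ℤ)).map (Int.castRingHom ℚ)).mordellWeilRank =
      (((⟨a₁, a₂, a₃, a₄, a₆⟩ : WeierstrassCurve ℤ)).map (Int.castRingHom ℚ)).mordellWeilRank := by
    rw [hV]; exact WeierstrassCurve.mordellWeilRank_variableChange_holds _ _
  rw [← hr] at hlow ⊢
  exact rank_eq_of_certsRLe r fr ccr hF hpr hc hlow

end Summit.BirchSwinnertonDyer.BirchSwinnertonDyer.Rank2Observatory.TwoDescCl

end
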